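import Mathlib.RingTheory.Ideal.CotangentBaseChange
import Mathlib.RingTheory.TensorProduct.Quotient
import Mathlib.LinearAlgebra.Charpoly.BaseChange
import HarnessLib

/-!
# The conormal module `I/I²` of an augmentation ideal commutes with EVERY base change

Topic `Literature/RingTheory/Smooth`, namespace `Literature.RingTheory.Smooth`.  THEOREMS (and two harmless abbreviations)
only; everything is proved from Mathlib (`RingTheory/Ideal/CotangentBaseChange`); no named fact (net debt 0).

THE SETTING.  `R` a commutative ring, `S` a commutative `R`-algebra with an AUGMENTATION `ε : S →ₐ[R] R` (so `R → S → R`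
is the identity), `I = ker ε` the augmentation ideal, and `T` any commutative `R`-algebra; `I_T = I·(T ⊗_R S)` the extended
ideal, which is the augmentation ideal of the base-changed augmentation `ε_T : T ⊗_R S → T`.  This is the affine algebra
of a SECTION `e : Spec R → U = Spec S` of an affine `R`-scheme — in the application (cell `hodgecm-mathlib`, row II-2β,
plan `PREP-II2beta-Prop26Qbar.md` step (S4a)), the unit section of a group scheme `𝒜 → Spec R` restricted to an affine
chart `U ∋ e(Spec R)`, and `I/I²` is the conormal module `e^*(𝒥/𝒥²) = ω_{𝒜/R}` of Görtz–Wedhorn / EGA IV₄ §16.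

THE PRINT.  Mathlib proves (`Ideal.tensorCotangentHom`, C. Merten 2025) that the canonical map
`T ⊗_R I/I² → I_T/I_T²` is always surjective and is injective when `T` is FLAT over `R` (Stacks, Tag 00RU-style base
change of the naive cotangent complex).  For an AUGMENTATION ideal flatness is not needed: `S = R ⊕ I` as `R`-modules, so
`I/I² → S/I²` is a SPLIT injection of `R`-modules (retraction `s ↦ s − ε(s) mod I²`), and split injections survive every
tensor product.  This is the algebra behind «the conormal sheaf of a section commutes with arbitrary base change»
(EGA IV₄ (16.2.3 (ii)) with (16.4.9); Görtz–Wedhorn I, Remark 6.12 (2)–(3) for the fibre over a point: `T_{x'}(X ⊗_k k') =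
T_x(X) ⊗_k k'`), here for a NON-flat `T` such as a residue field `R → κ` — the case a specialisation argument needs.

WHAT IS PROVED.
* §1 `augmentationRetraction ε : S →ₗ[R] I` (`s ↦ s − ε(s)`), the splitting `S = R ⊕ I`; the `R`-linear retraction
  `cotangentRetraction ε : S ⧸ I² →ₗ[R] I/I²` of Mathlib's `I.cotangentToQuotientSquare`.
* §2 the base-changed augmentation `baseChangeAugmentation T ε : T ⊗_R S →ₐ[T] T` and
  `ker_baseChangeAugmentation : ker ε_T = I.map includeRight`.
* §3 **`tensorCotangentHom_injective_of_augmentation`**: `Ideal.tensorCotangentHom R T I` is injective for EVERY `T`; hence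
  the `T`-linear isomorphism **`tensorCotangentEquivOfAugmentation : T ⊗_R I/I² ≃ₗ[T] I_T/I_T²`** (`_tmul` formula).
* §4 naturality in an endomorphism `g` of the augmented algebra (`ε ∘ g = ε`): the action `Ideal.mapCotangent` of `g` on
  `I/I²` base-changes to the action of `g_T = T ⊗ g` on `I_T/I_T²` (`tensorCotangentEquivOfAugmentation_naturality`), hence
  **`charpoly_mapCotangent_baseChange`**: for `I/I²` free of finite rank over `R`, the characteristic polynomial of `g_T` on
  `I_T/I_T²` is the image under `R → T` of that of `g` on `I/I²` — the form in which a specialisation argument reads «the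
  characteristic polynomial of an endomorphism on the cotangent space of every fibre is ONE polynomial over the base».
Not here: the scheme-theoretic dictionary (chart `Spec S ⊆ 𝒜` ↔ stalk cotangent space of the fibre), which lives with
the consumer.

## References
* [EGAIV4] A. Grothendieck, J. Dieudonné, *EGA IV₄*, Publ. Math. IHÉS 32 (1967), §16.2 (16.2.3), §16.4 (16.4.9).
* [GortzWedhorn2020] U. Görtz, T. Wedhorn, *Algebraic Geometry I*, 2nd ed., Remark 6.12 (2)–(3), (6.6.2)–(6.6.3).
* [StacksProject] The Stacks project, Tag 00RU (base change and the naive cotangent complex).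
-/

noncomputable section

open TensorProduct

namespace Literature.RingTheory.Smooth

universe u v w

variable {R : Type u} {S : Type v} [CommRing R] [CommRing S] [Algebra R S] (ε : S →ₐ[R] R)

/-! ## §1. The splitting `S = R ⊕ I` and the retraction of `I/I² → S/I²` -/

/-- The augmentation ideal `I = ker ε` of an augmented `R`-algebra `(S, ε)`. [folklore] -/
abbrev augIdeal : Ideal S := RingHom.ker ε.toRingHom

/-- `s ∈ I ↔ ε s = 0`. [cite: StacksProject, Tag 00RU (naive cotangent complex and base change); cf. EGA IV (16.2.3)] -/
theorem mem_augIdeal_iff (s : S) : s ∈ augIdeal ε ↔ ε s = 0 := RingHom.mem_ker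

/-- `s − ε(s) ∈ I` (the projection of `S = R ⊕ I` onto `I`). [cite: StacksProject, Tag 00RU (naive cotangent complex and base change); cf. EGA IV (16.2.3)] -/
theorem sub_algebraMap_mem_augIdeal (s : S) : s - algebraMap R S (ε s) ∈ augIdeal ε := by
  rw [mem_augIdeal_iff, map_sub, AlgHom.commutes, Algebra.algebraMap_self, RingHom.id_apply, sub_self]

/-- **The `R`-linear retraction `S → I`, `s ↦ s − ε(s)`** of the inclusion `I ⊆ S` (the splitting `S = R ⊕ I` of an
augmented algebra). [folklore] -/
def augmentationRetraction : S →ₗ[R] augIdeal ε where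
  toFun s := ⟨s - algebraMap R S (ε s), sub_algebraMap_mem_augIdeal ε s⟩
  map_add' s t := by
    ext
    simp only [map_add, Submodule.coe_add]
    ring
  map_smul' c s := by
    ext
    simp only [RingHom.id_apply, Submodule.coe_smul_of_tower, Algebra.smul_def, map_mul, AlgHom.commutes,
      Algebra.algebraMap_self]
    ring

/-- Unfolding `augmentationRetraction`. [cite: StacksProject, Tag 00RU (naive cotangent complex and base change); cf. EGA IV (16.2.3)] -/
@[simp] theorem coe_augmentationRetraction (s : S) :
    (augmentationRetraction ε s : S) = s - algebraMap R S (ε s) := rfl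

/-- The retraction is the identity on `I`. [cite: StacksProject, Tag 00RU (naive cotangent complex and base change); cf. EGA IV (16.2.3)] -/
theorem augmentationRetraction_coe (x : augIdeal ε) : augmentationRetraction ε (x : S) = x := by
  ext
  rw [coe_augmentationRetraction, (mem_augIdeal_iff ε _).1 x.2, map_zero, sub_zero]

/-- The `R`-linear map `S → I/I²`, `s ↦ (s − ε s) mod I²`; it kills `I²`. [folklore] -/
def toCotangentOfAugmentation : S →ₗ[R] (augIdeal ε).Cotangent :=
  ((augIdeal ε).toCotangent.restrictScalars R) ∘ₗ augmentationRetraction ε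

/-- Unfolding `toCotangentOfAugmentation`. [cite: StacksProject, Tag 00RU (naive cotangent complex and base change); cf. EGA IV (16.2.3)] -/
theorem toCotangentOfAugmentation_apply (s : S) :
    toCotangentOfAugmentation ε s = (augIdeal ε).toCotangent (augmentationRetraction ε s) := rfl

/-- `toCotangentOfAugmentation` is `toCotangent` on `I`. [cite: StacksProject, Tag 00RU (naive cotangent complex and base change); cf. EGA IV (16.2.3)] -/
theorem toCotangentOfAugmentation_coe (x : augIdeal ε) :
    toCotangentOfAugmentation ε (x : S) = (augIdeal ε).toCotangent x := by
  rw [toCotangentOfAugmentation_apply, augmentationRetraction_coe]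

/-- `toCotangentOfAugmentation` vanishes on `I²`. [cite: StacksProject, Tag 00RU (naive cotangent complex and base change); cf. EGA IV (16.2.3)] -/
theorem toCotangentOfAugmentation_eq_zero_of_mem_sq {s : S} (hs : s ∈ augIdeal ε ^ 2) :
    toCotangentOfAugmentation ε s = 0 := by
  have hsI : s ∈ augIdeal ε := Ideal.pow_le_self two_ne_zero hs
  rw [show s = ((⟨s, hsI⟩ : augIdeal ε) : S) from rfl, toCotangentOfAugmentation_coe, Ideal.toCotangent_eq_zero]
  exact hs

/-- **The `R`-linear retraction `S/I² → I/I²`** of Mathlib's `cotangentToQuotientSquare : I/I² → S/I²`: the projection of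
`S/I² = R ⊕ I/I²`. [folklore] -/
def cotangentRetraction : (S ⧸ augIdeal ε ^ 2) →ₗ[R] (augIdeal ε).Cotangent :=
  (((augIdeal ε ^ 2).restrictScalars R).liftQ (toCotangentOfAugmentation ε) fun s hs => by
      exact LinearMap.mem_ker.2 (toCotangentOfAugmentation_eq_zero_of_mem_sq ε hs)) ∘ₗ
    (Submodule.Quotient.restrictScalarsEquiv R (augIdeal ε ^ 2)).symm.toLinearMap

/-- `cotangentRetraction (s mod I²) = (s − ε s) mod I²`. [cite: StacksProject, Tag 00RU (naive cotangent complex and base change); cf. EGA IV (16.2.3)] -/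
theorem cotangentRetraction_mkQ (s : S) :
    cotangentRetraction ε ((augIdeal ε ^ 2).mkQ s) = toCotangentOfAugmentation ε s := rfl

/-- **`I/I² → S/I²` is a split injection of `R`-modules**: `cotangentRetraction ∘ cotangentToQuotientSquare = id`.
[cite: StacksProject, Tag 00RU (naive cotangent complex and base change); cf. EGA IV (16.2.3)] -/
theorem cotangentRetraction_cotangentToQuotientSquare (x : (augIdeal ε).Cotangent) :
    cotangentRetraction ε ((augIdeal ε).cotangentToQuotientSquare x) = x := by
  obtain ⟨x, rfl⟩ := (augIdeal ε).toCotangent_surjective x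
  rw [Ideal.toCotangent_to_quotient_square, cotangentRetraction_mkQ, toCotangentOfAugmentation_coe]

/-! ## §2. The base-changed augmentation `ε_T : T ⊗_R S → T` and its kernel -/

section BaseChange

variable (T : Type w) [CommRing T] [Algebra R T]

/-- **The base-changed augmentation** `ε_T : T ⊗_R S →ₐ[T] T`, `t ⊗ s ↦ t · ε(s)`. [folklore] -/
def baseChangeAugmentation : T ⊗[R] S →ₐ[T] T :=
  Algebra.TensorProduct.lift (AlgHom.id T T) ((Algebra.ofId R T).comp ε) fun _ _ => Commute.all _ _

/-- `ε_T (t ⊗ s) = t · ε(s)`. [cite: StacksProject, Tag 00RU (naive cotangent complex and base change); cf. EGA IV (16.2.3)] -/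
@[simp] theorem baseChangeAugmentation_tmul (t : T) (s : S) :
    baseChangeAugmentation ε T (t ⊗ₜ[R] s) = t * algebraMap R T (ε s) := by
  simp [baseChangeAugmentation, Algebra.ofId_apply]

/-- The extended ideal `I_T = I · (T ⊗_R S)` (Mathlib's spelling, through `includeRight`). [folklore] -/
abbrev augIdealBaseChange : Ideal (T ⊗[R] S) :=
  (augIdeal ε).map (Algebra.TensorProduct.includeRight.toRingHom : S →+* T ⊗[R] S)

/-- `includeRight x = 1 ⊗ x ∈ I_T` for `x ∈ I`. [cite: StacksProject, Tag 00RU (naive cotangent complex and base change); cf. EGA IV (16.2.3)] -/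
theorem one_tmul_mem_augIdealBaseChange (x : augIdeal ε) : (1 : T) ⊗ₜ[R] (x : S) ∈ augIdealBaseChange ε T :=
  Ideal.mem_map_of_mem (Algebra.TensorProduct.includeRight.toRingHom : S →+* T ⊗[R] S) x.2

/-- `(r • t) ⊗ 1 = t ⊗ r·1`: moving a scalar of `R` across the tensor sign. [cite: StacksProject, Tag 00RU (naive cotangent complex and base change); cf. EGA IV (16.2.3)] -/
theorem mul_algebraMap_tmul_one (t : T) (r : R) :
    (t * algebraMap R T r) ⊗ₜ[R] (1 : S) = t ⊗ₜ[R] algebraMap R S r := by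
  rw [mul_comm, ← Algebra.smul_def, TensorProduct.smul_tmul, Algebra.algebraMap_eq_smul_one]

/-- `x − ε_T(x) ⊗ 1 ∈ I_T` for every `x ∈ T ⊗_R S` (the projection of `T ⊗ S = T ⊕ I_T`). [cite: StacksProject, Tag 00RU (naive cotangent complex and base change); cf. EGA IV (16.2.3)] -/
theorem sub_algebraMap_baseChangeAugmentation_mem (x : T ⊗[R] S) :
    x - algebraMap T (T ⊗[R] S) (baseChangeAugmentation ε T x) ∈ augIdealBaseChange ε T := by
  induction x using TensorProduct.induction_on with
  | zero => simp
  | tmul t s =>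
    have h : t ⊗ₜ[R] s - algebraMap T (T ⊗[R] S) (baseChangeAugmentation ε T (t ⊗ₜ[R] s)) =
        (t ⊗ₜ[R] (1 : S)) * ((1 : T) ⊗ₜ[R] (s - algebraMap R S (ε s))) := by
      rw [baseChangeAugmentation_tmul, Algebra.TensorProduct.algebraMap_apply, Algebra.algebraMap_self,
        RingHom.id_apply, mul_algebraMap_tmul_one, Algebra.TensorProduct.tmul_mul_tmul, mul_one, one_mul,
        TensorProduct.tmul_sub]
    rw [h]
    exact Ideal.mul_mem_left _ _ (one_tmul_mem_augIdealBaseChange ε T ⟨_, sub_algebraMap_mem_augIdeal ε s⟩)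
  | add x y hx hy =>
    have e : x + y - algebraMap T (T ⊗[R] S) (baseChangeAugmentation ε T (x + y)) =
        (x - algebraMap T (T ⊗[R] S) (baseChangeAugmentation ε T x)) +
          (y - algebraMap T (T ⊗[R] S) (baseChangeAugmentation ε T y)) := by
      rw [map_add, map_add]; abel
    rw [e]
    exact Ideal.add_mem _ hx hy

/-- `ε_T` kills `I_T`. [cite: StacksProject, Tag 00RU (naive cotangent complex and base change); cf. EGA IV (16.2.3)] -/
theorem baseChangeAugmentation_eq_zero_of_mem {x : T ⊗[R] S} (hx : x ∈ augIdealBaseChange ε T) :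
    baseChangeAugmentation ε T x = 0 := by
  induction hx using Submodule.span_induction with
  | mem x hx =>
    obtain ⟨y, hy, rfl⟩ := hx
    rw [AlgHom.toRingHom_eq_coe, RingHom.coe_coe, Algebra.TensorProduct.includeRight_apply, baseChangeAugmentation_tmul,
      (mem_augIdeal_iff ε y).1 hy, map_zero, mul_zero]
  | zero => exact map_zero _
  | add x y _ _ hx hy => rw [map_add, hx, hy, add_zero]
  | smul a x _ hx => rw [smul_eq_mul, map_mul, hx, mul_zero]

/-- **`ker ε_T = I_T = I · (T ⊗_R S)`**: the augmentation ideal of the base change is the extended ideal. [cite: StacksProject, Tag 00RU (naive cotangent complex and base change); cf. EGA IV (16.2.3)] -/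
theorem ker_baseChangeAugmentation :
    RingHom.ker (baseChangeAugmentation ε T).toRingHom = augIdealBaseChange ε T := by
  apply le_antisymm
  · intro x hx
    have h := sub_algebraMap_baseChangeAugmentation_mem ε T x
    have hx' : baseChangeAugmentation ε T x = 0 := hx
    rwa [hx', map_zero, sub_zero] at h
  · intro x hx
    exact (RingHom.mem_ker).2 (baseChangeAugmentation_eq_zero_of_mem ε T hx)

/-! ## §3. `T ⊗_R I/I² → I_T/I_T²` is an isomorphism for EVERY `T` -/

-- The proof below is Mathlib's `Ideal.tensorCotangentHom_injective_of_flat` with flatness replaced by a retraction; like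
-- that lemma it needs backward-compatible `defeq` attribute handling for the `dsimp`/`simp` normalisation of `hₐ`.
set_option backward.defeqAttrib.useBackward true in
/-- **`T ⊗_R I/I² → I_T/I_T²` is injective as soon as `I/I² → S/I²` is a SPLIT injection of `R`-modules** (no
flatness of `T`).  Mathlib's proof for flat `T` (`Ideal.tensorCotangentHom_injective_of_flat`) composes with the injection
`I_T/I_T² ↪ (T ⊗ S)/I_T² ≅ T ⊗_R S/I²` and uses flatness only to know that `T ⊗_R (I/I² → S/I²)` is injective; a
retraction `p` of `I/I² → S/I²` gives the left inverse `T ⊗ p` instead.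
[cite: GortzWedhorn2020, Remark 6.12 (2)–(3)] [cite: EGAIV4, (16.2.3) and (16.4.9)] -/
theorem tensorCotangentHom_injective_of_retraction (I : Ideal S) (p : (S ⧸ I ^ 2) →ₗ[R] I.Cotangent)
    (hp : ∀ x : I.Cotangent, p (I.cotangentToQuotientSquare x) = x) :
    Function.Injective (I.tensorCotangentHom R T) := by
  let a : S →+* T ⊗[R] S := Algebra.TensorProduct.includeRight.toRingHom
  let f : (I.map a).Cotangent →ₗ[T] T ⊗[R] S ⧸ (I.map a) ^ 2 :=
    (Ideal.cotangentToQuotientSquare _).restrictScalars T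
  suffices h : Function.Injective (f ∘ₗ Ideal.tensorCotangentHom R T I) from .of_comp h
  let g : T ⊗[R] I.Cotangent →ₗ[T] T ⊗[R] (S ⧸ I ^ 2) :=
    AlgebraTensorModule.lTensor T T I.cotangentToQuotientSquare
  let hₐ : T ⊗[R] (S ⧸ I ^ 2) ≃ₐ[T] T ⊗[R] S ⧸ (I.map a) ^ 2 :=
    (Algebra.TensorProduct.tensorQuotientEquiv _ _ _ _).trans
      (Ideal.quotientEquivAlgOfEq T (Ideal.map_pow _ _ _))
  have hfg : f ∘ₗ Ideal.tensorCotangentHom R T I = hₐ.toLinearMap ∘ₗ g := by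
    ext x
    obtain ⟨x, rfl⟩ := I.toCotangent_surjective x
    dsimp [f, g, hₐ]
    rw [Ideal.tensorCotangentHom_tmul, one_smul, Ideal.toCotangent_to_quotient_square]
    simp
  rw [hfg, LinearMap.coe_comp]
  apply hₐ.injective.comp
  -- `g = T ⊗ (I/I² → S/I²)` has the left inverse `T ⊗ p`
  let q : T ⊗[R] (S ⧸ I ^ 2) →ₗ[T] T ⊗[R] I.Cotangent := AlgebraTensorModule.lTensor T T p
  refine Function.LeftInverse.injective (g := q) fun z => ?_
  induction z using TensorProduct.induction_on with
  | zero => rw [map_zero, map_zero]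
  | tmul t x =>
    change t ⊗ₜ[R] p (I.cotangentToQuotientSquare x) = t ⊗ₜ[R] x
    rw [hp]
  | add x y hx hy => rw [map_add, map_add, hx, hy]

/-- **`T ⊗_R I/I² → I_T/I_T²` is injective for every `R`-algebra `T`** (no flatness), for the augmentation ideal `I` of
an augmented `R`-algebra: `I/I² → S/I²` is split by `cotangentRetraction`.
[cite: GortzWedhorn2020, Remark 6.12 (2)–(3)] [cite: EGAIV4, (16.2.3) and (16.4.9)] -/
theorem tensorCotangentHom_injective_of_augmentation :
    Function.Injective ((augIdeal ε).tensorCotangentHom R T) :=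
  tensorCotangentHom_injective_of_retraction T (augIdeal ε) (cotangentRetraction ε)
    (cotangentRetraction_cotangentToQuotientSquare ε)

/-- **The conormal module of an augmentation ideal commutes with every base change:
`T ⊗_R I/I² ≃ₗ[T] I_T/I_T²`.** [cite: GortzWedhorn2020, Remark 6.12 (2)–(3)] [cite: EGAIV4, (16.2.3) and (16.4.9)] -/
def tensorCotangentEquivOfAugmentation :
    T ⊗[R] (augIdeal ε).Cotangent ≃ₗ[T] (augIdealBaseChange ε T).Cotangent :=
  LinearEquiv.ofBijective ((augIdeal ε).tensorCotangentHom R T)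
    ⟨tensorCotangentHom_injective_of_augmentation ε T, Ideal.tensorCotangentHom_surjective R T _⟩

/-- `tensorCotangentEquivOfAugmentation (t ⊗ x̄) = t · (1 ⊗ x)‾`. [cite: StacksProject, Tag 00RU (naive cotangent complex and base change); cf. EGA IV (16.2.3)] -/
theorem tensorCotangentEquivOfAugmentation_tmul (t : T) (x : augIdeal ε) :
    tensorCotangentEquivOfAugmentation ε T (t ⊗ₜ[R] (augIdeal ε).toCotangent x) =
      t • (augIdealBaseChange ε T).toCotangent ⟨(1 : T) ⊗ₜ[R] (x : S), one_tmul_mem_augIdealBaseChange ε T x⟩ :=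
  rfl

/-! ## §4. Naturality in an augmented endomorphism; characteristic polynomials -/

variable {ε} in
/-- An `R`-algebra endomorphism `g` of `S` compatible with the augmentation (`ε ∘ g = ε`) maps `I` into `I`. [cite: StacksProject, Tag 00RU (naive cotangent complex and base change); cf. EGA IV (16.2.3)] -/
theorem augIdeal_le_comap {g : S →ₐ[R] S} (hg : ε.comp g = ε) : augIdeal ε ≤ (augIdeal ε).comap g := by
  intro x hx
  rw [Ideal.mem_comap, mem_augIdeal_iff, ← AlgHom.comp_apply, hg]
  exact (mem_augIdeal_iff ε x).1 hx

/-- The base change `g_T = T ⊗ g` of an augmented endomorphism maps `I_T` into `I_T`. [cite: StacksProject, Tag 00RU (naive cotangent complex and base change); cf. EGA IV (16.2.3)] -/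
theorem augIdealBaseChange_le_comap (g : S →ₐ[R] S) (hg : ε.comp g = ε) :
    augIdealBaseChange ε T ≤ (augIdealBaseChange ε T).comap (Algebra.TensorProduct.map (AlgHom.id T T) g) := by
  rw [augIdealBaseChange, Ideal.map_le_iff_le_comap]
  intro x hx
  rw [Ideal.mem_comap, Ideal.mem_comap, AlgHom.toRingHom_eq_coe, RingHom.coe_coe,
    Algebra.TensorProduct.includeRight_apply, Algebra.TensorProduct.map_tmul, AlgHom.id_apply]
  exact one_tmul_mem_augIdealBaseChange ε T ⟨g x, augIdeal_le_comap hg hx⟩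

/-- **Naturality of `T ⊗_R I/I² ≅ I_T/I_T²` in an augmented endomorphism `g`**: the base change of the action of `g` on
`I/I²` is the action of `g_T = T ⊗ g` on `I_T/I_T²`. [cite: StacksProject, Tag 00RU (naive cotangent complex and base change); cf. EGA IV (16.2.3)] -/
theorem tensorCotangentEquivOfAugmentation_naturality (g : S →ₐ[R] S) (hg : ε.comp g = ε)
    (z : T ⊗[R] (augIdeal ε).Cotangent) :
    tensorCotangentEquivOfAugmentation ε T
        (((augIdeal ε).mapCotangent (augIdeal ε) g (augIdeal_le_comap hg)).baseChange T z) =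
      (augIdealBaseChange ε T).mapCotangent (augIdealBaseChange ε T)
        (Algebra.TensorProduct.map (AlgHom.id T T) g) (augIdealBaseChange_le_comap ε T g hg)
        (tensorCotangentEquivOfAugmentation ε T z) := by
  induction z using TensorProduct.induction_on with
  | zero => simp only [map_zero]
  | tmul t x =>
    obtain ⟨x, rfl⟩ := (augIdeal ε).toCotangent_surjective x
    rw [LinearMap.baseChange_tmul, Ideal.mapCotangent_toCotangent, tensorCotangentEquivOfAugmentation_tmul,
      tensorCotangentEquivOfAugmentation_tmul, map_smul, Ideal.mapCotangent_toCotangent]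
    congr 2
  | add x y hx hy => simp only [map_add, hx, hy]

/-- The same naturality as an identity of `T`-linear maps: `g_T^* = Φ ∘ (T ⊗ g^*) ∘ Φ⁻¹` on `I_T/I_T²`. [cite: StacksProject, Tag 00RU (naive cotangent complex and base change); cf. EGA IV (16.2.3)] -/
theorem mapCotangent_baseChange_eq_conj (g : S →ₐ[R] S) (hg : ε.comp g = ε) :
    (augIdealBaseChange ε T).mapCotangent (augIdealBaseChange ε T)
        (Algebra.TensorProduct.map (AlgHom.id T T) g) (augIdealBaseChange_le_comap ε T g hg) =
      (tensorCotangentEquivOfAugmentation ε T).conj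
        (((augIdeal ε).mapCotangent (augIdeal ε) g (augIdeal_le_comap hg)).baseChange T) := by
  refine LinearMap.ext fun y => ?_
  obtain ⟨z, rfl⟩ := (tensorCotangentEquivOfAugmentation ε T).surjective y
  rw [LinearEquiv.conj_apply, LinearMap.comp_apply, LinearMap.comp_apply, LinearEquiv.coe_coe, LinearEquiv.coe_coe,
    LinearEquiv.symm_apply_apply, tensorCotangentEquivOfAugmentation_naturality ε T g hg]

/-- **The characteristic polynomial of an augmented endomorphism on the conormal module is compatible with every base
change**: if `I/I²` is free of finite rank over `R`, then for every `R`-algebra `T` the characteristic polynomial of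
`g_T^*` on `I_T/I_T²` is the image under `R → T` of that of `g^*` on `I/I²` — so the cotangent characteristic polynomial of
an endomorphism fixing a section is ONE polynomial over the base, read in every fibre (the input of a specialisation
argument for CM types). [cite: GortzWedhorn2020, Remark 6.12 (2)–(3)] -/
theorem charpoly_mapCotangent_baseChange [Module.Free R (augIdeal ε).Cotangent] [Module.Finite R (augIdeal ε).Cotangent]
    (g : S →ₐ[R] S) (hg : ε.comp g = ε) :
    haveI := Module.Free.of_equiv (tensorCotangentEquivOfAugmentation ε T)
    haveI := Module.Finite.equiv (tensorCotangentEquivOfAugmentation ε T)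
    ((augIdealBaseChange ε T).mapCotangent (augIdealBaseChange ε T)
        (Algebra.TensorProduct.map (AlgHom.id T T) g) (augIdealBaseChange_le_comap ε T g hg)).charpoly =
      (((augIdeal ε).mapCotangent (augIdeal ε) g (augIdeal_le_comap hg)).charpoly).map (algebraMap R T) := by
  haveI := Module.Free.of_equiv (tensorCotangentEquivOfAugmentation ε T)
  haveI := Module.Finite.equiv (tensorCotangentEquivOfAugmentation ε T)
  rw [mapCotangent_baseChange_eq_conj ε T g hg, LinearEquiv.charpoly_conj, LinearMap.charpoly_baseChange]

end BaseChange

end Literature.RingTheory.Smooth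

end
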